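import Literature.Claims.NS.Karadzhov2026
import Literature.Analysis.FluidPDE.TorusGalerkinCriticalSobolevSmallData
import Literature.Analysis.FluidPDE.NSGalerkinFieldToCoeff
import Literature.Analysis.FunctionSpaces.TorusTruncationH1
import Literature.Analysis.FunctionSpaces.TorusFractionalSobolevEmbedding
import HarnessLib

/-!
# C174 `Karadzhov2026` — TRUE column: the honest small-data face `Step_T82_energy` holds

D-0090 NS-CLAIMS SWEEP, salvage-p4 (g5). Row C174 (ADJUDICATED #159). The print's Thm 8.2
display (28) p.16 («sup_{0≤t≤T}‖A^{1/4}u_N‖² + ν∫₀ᵀ‖A^{3/4}u_N‖² ≤ ‖A^{1/4}P_N u₀‖²», typed as the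
RECORDED `Step_T82`) is false by the factor-2 slip (the sup already equals the initial value); its
proof line p.16 l.226–235 («½X′_N + (ν/2)Y_N ≤ 0 … integrating») yields the TRUE face
`Step_T82_energy` (skeleton rev 2 p555093, l.582): for small critical data every Galerkin solution
obeys `critSq (U t) + 4π²ν∫₀ᵗ crit3Sq (U s) ds ≤ critSq u₀` for each `t`, uniformly in the cutoff.
This file DISCHARGES it in the kernel from the tree's Galerkin-level Chemin/Fujita–Kato estimate
(`IsGalerkinTrajectory.critSobolev_add_integral_le`, `TorusGalerkinCriticalSobolevSmallData`,
Robinson–Rodrigo–Sadowski 2016 Cor 10.2 (ii) / Thm 10.1 proof) transported to the skeleton's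
field-level Galerkin solutions (`IsGalerkin` = `Torus.IsGalerkinTrajectory ν 0 N U ∧ U 0 = P_N u₀`)
by the dictionary `Torus.IsGalerkinTrajectory.isGalerkinTrajectory_fourierRestrict`
(`NSGalerkinFieldToCoeff`). RECORDED step, not on the large-data path — nothing keyed by #159 moves.

WHAT THIS IS NOT: not a claim about NS regularity or blow-up; not a claim about any author beyond the
typed locator.
-/

noncomputable section

open MeasureTheory Set Filter UnitAddTorus
open scoped ENNReal NNReal InnerProductSpace

-- The summit's canonical theorem namespace repeats the summit name (single-conjunct summit).
set_option linter.dupNamespace false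

namespace Summit.NavierStokesRegularity.NavierStokesRegularity.Theorems.Karadzhov2026

open Literature.Analysis Literature.Analysis.FluidPDE Literature.Analysis.FunctionSpaces
  Literature.Analysis.FunctionSpaces.Torus
open Literature.Claims.NS.Karadzhov2026
open Literature.Claims.NS.Higgins2026 (T3 E3 C3 Z3 coeff latt)

/-- The lattice norm of the skeleton is `|k| = (freqNormSq k)^{1/2}`. [folklore] -/
private theorem latt_eq_rpow (k : Z3) : latt k = freqNormSq k ^ (1 / 2 : ℝ) := by
  rw [latt, Real.sqrt_eq_rpow]

/-- `|k|³ = (freqNormSq k)^{3/2}`. [folklore] -/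
private theorem latt_pow_three (k : Z3) : latt k ^ 3 = freqNormSq k ^ (3 / 2 : ℝ) := by
  rw [latt_eq_rpow, ← Real.rpow_natCast, ← Real.rpow_mul (freqNormSq_nonneg k)]
  norm_num

/-- The weighted critical sums of a Galerkin mode of order `N` are finite sums over the Fourier
ball of its restricted coefficients. [folklore] -/
private theorem tsum_mul_norm_coeff_sq_eq {N : ℕ} {v : T3 → E3} (hv : IsGalerkinMode N v)
    (w : Z3 → ℝ) :
    ∑' k : Z3, w k * ‖coeff v k‖ ^ 2 =
      ∑ k : ↥(freqBall N), w k * ‖fourierRestrict (freqBall N) v k‖ ^ 2 := by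
  rw [tsum_eq_sum (s := freqBall N) fun k hk => by
    rw [coeff, hv.mFourierCoeff_eq_zero (not_mem_freqBall.1 hk), norm_zero]; ring,
    ← Finset.sum_coe_sort (freqBall N)]
  rfl

/-- **`Step_T82_energy` holds** (Thm 8.2's proof-line face p.16 l.226–235; Robinson–Rodrigo–Sadowski
2016 Cor 10.2 (ii) / Chemin 1992 at the Galerkin level): there is an absolute `c > 0` such that for
every `ν > 0`, every smooth divergence-free mean-zero datum with `critSq u₀ ≤ (cν)²`, every cutoff
`N` and every field-level Galerkin solution `U` from `P_N u₀`, for every `T > 0` and `t ∈ [0, T]`: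
`critSq (U t) + 4π²ν ∫₀ᵗ crit3Sq (U s) ds ≤ critSq u₀`. Proof: the tree's cutoff-uniform bound
`IsGalerkinTrajectory.critSobolev_add_integral_le` applied to the coefficient trajectory of `U`
(`Torus.IsGalerkinTrajectory.isGalerkinTrajectory_fourierRestrict`), the datum `P_N u₀` being
mean-zero with `∑_{|k|≤N}|k|‖û₀(k)‖² ≤ critSq u₀`.
[cite: Karadzhov2026, Thm 8.2 (27)–(28) p.16 l.67 – p.17 l.1; proof p.16 l.202–235]
[cite: RobinsonRodrigoSadowskiCUP2016, Cor 10.2 (ii), Thm 10.1 proof] -/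
theorem step_T82_energy_holds : Literature.Claims.NS.Karadzhov2026.Step_T82_energy := by
  obtain ⟨ε₀, hε₀, H⟩ :=
    IsGalerkinTrajectory.critSobolev_add_integral_le (d := Fin 3) (by simp)
  refine ⟨ε₀, hε₀, fun ν hν u₀ hu₀ hsmall N U hU T _hT t ht => ?_⟩
  obtain ⟨hsm, _hdiv, hmean⟩ := hu₀
  obtain ⟨htraj, hU0⟩ := hU
  have hu₀i : Integrable u₀ volume := hsm.continuous.integrable_unitAddTorus
  -- the coefficient trajectory of `U`
  have hf0 : MemLp (0 : T3 → E3) 2 volume := MemLp.zero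
  obtain ⟨hα, hvel⟩ := htraj.isGalerkinTrajectory_fourierRestrict hf0
  set S : Finset Z3 := freqBall N with hS_def
  set α : ℝ → ↥S → C3 := fun τ => fourierRestrict S (U (max τ 0)) with hα_def
  -- the datum `U 0 = P_N u₀` is mean-zero and its coefficients on the ball are those of `u₀`
  have hmean0 : HasZeroMean (U 0) := by
    rw [hU0]; exact hasZeroMean_fourierTruncate hu₀i hmean N
  have hc0 : ∀ k : ↥S, fourierRestrict S (U 0) k = coeff u₀ k := by
    intro k
    rw [fourierRestrict_apply, hU0, mFourierCoeff_fourierTruncate hu₀i, if_pos k.2]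
    rfl
  -- `X(P_N u₀) ≤ critSq u₀ ≤ (ε₀ ν)²`
  have hX0 : ∑ k : ↥S, freqNormSq (k : Z3) ^ (1 / 2 : ℝ) * ‖fourierRestrict S (U 0) k‖ ^ 2 ≤
      critSq u₀ := by
    have hsum := hsm.summable_freqNormSq_rpow_mul_norm_sq (s := 1 / 2) (by norm_num)
    have h1 := sum_rpow_mul_norm_sq_fourierRestrict_le (S := S) (u₀ := u₀) (1 / 2 : ℝ) hsum
    have h2 : ∑ k : ↥S, freqNormSq (k : Z3) ^ (1 / 2 : ℝ) * ‖fourierRestrict S (U 0) k‖ ^ 2 =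
        ∑ k : ↥S, freqNormSq (k : Z3) ^ (1 / 2 : ℝ) * ‖fourierRestrict S u₀ k‖ ^ 2 :=
      Finset.sum_congr rfl fun k _ => by rw [hc0 k, fourierRestrict_apply]; rfl
    rw [h2, critSq]
    refine h1.trans (le_of_eq (tsum_congr fun k => ?_))
    rw [latt_eq_rpow]; rfl
  have hsm' : Real.sqrt (∑ k : ↥S, freqNormSq (k : Z3) ^ (1 / 2 : ℝ) *
      ‖fourierRestrict S (U 0) k‖ ^ 2) ≤ ε₀ * ν := by
    calc Real.sqrt _ ≤ Real.sqrt (critSq u₀) := Real.sqrt_le_sqrt hX0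
      _ ≤ Real.sqrt ((ε₀ * ν) ^ 2) := Real.sqrt_le_sqrt hsmall
      _ = ε₀ * ν := Real.sqrt_sq (by positivity)
  -- the cutoff-uniform bound along the coefficient trajectory
  have main := H hν hα hmean0 hsm' t ht.1
  -- translate back to the skeleton's functionals
  have hαt : ∀ s, 0 ≤ s → α s = fourierRestrict S (U s) := fun s hs => by
    simp only [hα_def, max_eq_left hs]
  have hXt : critSq (U t) = ∑ k : ↥S, freqNormSq (k : Z3) ^ (1 / 2 : ℝ) * ‖α t k‖ ^ 2 := by
    rw [critSq, tsum_mul_norm_coeff_sq_eq (htraj.isGalerkinMode t ht.1), hαt t ht.1]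
    exact Finset.sum_congr rfl fun k _ => by rw [latt_eq_rpow]
  have hZ : ∫ s in (0 : ℝ)..t, crit3Sq (U s) =
      ∫ s in (0 : ℝ)..t, ∑ k : ↥S, freqNormSq (k : Z3) ^ (3 / 2 : ℝ) * ‖α s k‖ ^ 2 := by
    refine intervalIntegral.integral_congr fun s hs => ?_
    have hs0 : 0 ≤ s := by rw [uIcc_of_le ht.1] at hs; exact hs.1
    rw [crit3Sq, tsum_mul_norm_coeff_sq_eq (htraj.isGalerkinMode s hs0), hαt s hs0]
    exact Finset.sum_congr rfl fun k _ => by rw [latt_pow_three]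
  rw [hXt, hZ]
  exact main.trans hX0

end Summit.NavierStokesRegularity.NavierStokesRegularity.Theorems.Karadzhov2026
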